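import Literature.MathematicalPhysics.QuantumFieldTheory.CurvatureGaussianField
import HarnessLib

/-!
# `SourcedPressureIncrement` (stmt-QuantumFields-22517), helper: Fourier representation of the curvature
# (lattice Maxwell field-strength) kernel along one plane

For the two-plaquette kernel `curvatureTwoPoint` of `CurvatureGaussianField.lean`
(`(d (-Δ)⁻¹ d*)(p, q)`, the covariance of Garban–Sepúlveda's gradient spin-wave on `2`-forms /
the lattice Maxwell field strength on `ℤ^d`, `d ≥ 3`) restricted to PARALLEL plaquettes
`(x; i<j)`, `(y; i<j)` of one coordinate plane `P = (i<j)` this file proves: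

* `curvatureTwoPoint_plane_eq` — position space: `K = (transverse second differences of G)/2`,
  `G = latticeGreen`;
* **`curvatureTwoPoint_plane_eq_integral`** — momentum space:
  `K((x;P),(y;P)) = ∫_{[-π,π]^d} w(k) · 2((1 - cos kᵢ) + (1 - cos kⱼ)) · cos (k·(x-y)) dk`
  with the tree's weight `w(k) = greenFourierWeight d k = (2 (2π)^d ε(k))⁻¹`, i.e.
  `(2π)^{-d} ∫ m_P(k) cos (k·(x-y)) dk` with the MULTIPLIER
  `m_P(k) = ((1 - cos kᵢ) + (1 - cos kⱼ)) / ε(k)`, `ε(k) = ∑_l (1 - cos k_l)`;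
* `greenFourierWeight_mul_plane_multiplier_le` / `_nonneg` — `0 ≤ (2π)^{-d} m_P ≤ (2π)^{-d}`;
* **`sum_sum_mul_mul_curvatureTwoPoint_plane_eq_integral`** — the quadratic form along a finite
  family of parallel plaquettes in momentum space,
  `∑ⱼⱼ' cⱼ cⱼ' K((gⱼ;P),(gⱼ';P)) = ∫ w · 2((1-cos kᵢ)+(1-cos kⱼ)) · ∑_b (∑ⱼ cⱼ φ_b(gⱼ,k))² dk ≥ 0`
  (`…_nonneg`);
* the finite Parseval identity on the Brillouin zone
  (`integral_brillouin_sum_sq_sum_mul_siteFourierMode`: `∫ ∑_b (∑ⱼ cⱼ φ_b(gⱼ,k))² dk =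
  (2π)^d ∑ⱼⱼ' cⱼcⱼ'[gⱼ = gⱼ']`), the Fourier representation of `G/2` and of its second
  differences, and small measurability / integrability facts about `w`.

The consequences `0 ≤ K ≤ 1` along a plane (contraction bound, square-summable rows, Gram
matrices bounded by the identity) are in `SourcedPressureJensenSourcedPressureIncrementCurvatureKernelContraction.lean`.

Route `SourcedPressureJensen`, crux `SourcedPressureIncrement`, stub `stub_gauss` (uniform stability of the
curvature Gaussian field; second cumulant); also usable by `EntropyBudgetEquipartition` /
`EquipartitionCriticality` / `ColdBoxAllGroups`. Imports Literature only (no route file). RECORD-label rung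
support; the Yang–Mills mass gap is NOT proved by anything here.

Everything here is proved; no definition and no named fact is introduced. Sources: C. Garban,
A. Sepúlveda, IMRN 2023 (arXiv:2107.04021) §4 (law of the gradient spin-wave, covariance
`⟨f, dd*Δ⁻¹f⟩`); folklore lattice Fourier analysis (Friedli–Velenik 2017 §8.4).
-/

noncomputable section

open MeasureTheory Finset Real

namespace Summit.QuantumFields.YangMills.Theorems.CurvatureKernel

open Literature.Probability.LatticeModels Literature.MathematicalPhysics.QuantumLattice
  Literature.MathematicalPhysics.QuantumFieldTheory

variable {d : ℕ}

/-! ### Finite trigonometric sums on the Brillouin zone -/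

/-- The Fourier modes `cos (k·x)`, `sin (k·x)` are continuous in the momentum. [folklore] -/
@[fun_prop]
theorem continuous_siteFourierMode (b : Bool) (x : Literature.Probability.LatticeModels.Site d) : Continuous (siteFourierMode b x) := by
  have hc : Continuous fun k : Fin d → ℝ => Real.cos (∑ i, k i * (x i : ℝ)) := by fun_prop
  have hs : Continuous fun k : Fin d → ℝ => Real.sin (∑ i, k i * (x i : ℝ)) := by fun_prop
  cases b
  · exact hs
  · exact hc

/-- `∑_b (∑ⱼ cⱼ φ_b(gⱼ, k))² = ∑ⱼⱼ' cⱼ cⱼ' cos (k·(gⱼ - gⱼ'))`: the squared modulus of a finite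
trigonometric sum `∑ⱼ cⱼ e^{ik·gⱼ}`, in real form. [folklore] -/
theorem sum_sq_sum_mul_siteFourierMode {J : Type*} [Fintype J] (g : J → Literature.Probability.LatticeModels.Site d) (c : J → ℝ)
    (k : Fin d → ℝ) :
    ∑ b, (∑ j, c j * siteFourierMode b (g j) k) ^ 2 =
      ∑ j, ∑ j', c j * c j' * Real.cos (∑ i, k i * ((g j - g j') i : ℝ)) := by
  calc ∑ b, (∑ j, c j * siteFourierMode b (g j) k) ^ 2
      = ∑ b, ∑ j, ∑ j', c j * siteFourierMode b (g j) k * (c j' * siteFourierMode b (g j') k) := by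
        refine Finset.sum_congr rfl fun b _ => ?_
        rw [sq, Finset.sum_mul_sum]
    _ = ∑ j, ∑ j', ∑ b, c j * siteFourierMode b (g j) k * (c j' * siteFourierMode b (g j') k) := by
        rw [Finset.sum_comm]
        exact Finset.sum_congr rfl fun j _ => Finset.sum_comm
    _ = ∑ j, ∑ j', c j * c j' * Real.cos (∑ i, k i * ((g j - g j') i : ℝ)) := by
        refine Finset.sum_congr rfl fun j _ => Finset.sum_congr rfl fun j' _ => ?_
        rw [← sum_siteFourierMode_mul, Finset.mul_sum]
        exact Finset.sum_congr rfl fun b _ => by ring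

/-- **Parseval for finite trigonometric sums on the Brillouin zone**:
`∫_{[-π,π]^d} ∑_b (∑ⱼ cⱼ φ_b(gⱼ, k))² dk = (2π)^d ∑ⱼⱼ' cⱼ cⱼ' [gⱼ = gⱼ']` (orthogonality of the
characters of `ℤ^d`, tree `integral_brillouin_cos_sum_mul`); `= (2π)^d ∑ⱼ cⱼ²` for an injective
family `g`. [folklore] -/
theorem integral_brillouin_sum_sq_sum_mul_siteFourierMode {J : Type*} [Fintype J]
    (g : J → Literature.Probability.LatticeModels.Site d) (c : J → ℝ) :
    ∫ k in brillouin d, ∑ b, (∑ j, c j * siteFourierMode b (g j) k) ^ 2 =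
      (2 * π) ^ d * ∑ j, ∑ j', c j * c j' * (if g j = g j' then 1 else 0) := by
  simp_rw [sum_sq_sum_mul_siteFourierMode]
  have hI : ∀ j j', Integrable (fun k : Fin d → ℝ => c j * c j' * Real.cos (∑ i, k i * ((g j - g j') i : ℝ)))
      ((volume : Measure (Fin d → ℝ)).restrict (brillouin d)) := by
    intro j j'
    have hc : Continuous fun k : Fin d → ℝ => c j * c j' * Real.cos (∑ i, k i * ((g j - g j') i : ℝ)) := by
      fun_prop
    exact hc.continuousOn.integrableOn_compact (isCompact_brillouin d)
  rw [integral_finsetSum _ fun j _ => integrable_finsetSum _ fun j' _ => hI j j', Finset.mul_sum]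
  refine Finset.sum_congr rfl fun j _ => ?_
  rw [integral_finsetSum _ fun j' _ => hI j j', Finset.mul_sum]
  refine Finset.sum_congr rfl fun j' _ => ?_
  rw [integral_const_mul, integral_brillouin_cos_sum_mul]
  by_cases h : g j = g j'
  · simp [h, mul_comm]
  · have h' : g j - g j' ≠ 0 := sub_ne_zero.mpr h
    simp [h, h']

/-- Parseval, injective family: `∫ ∑_b (∑ⱼ cⱼ φ_b(gⱼ, k))² dk = (2π)^d ∑ⱼ cⱼ²`. [folklore] -/
theorem integral_brillouin_sum_sq_sum_mul_siteFourierMode_of_injective {J : Type*} [Fintype J]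
    {g : J → Literature.Probability.LatticeModels.Site d} (hg : Function.Injective g) (c : J → ℝ) :
    ∫ k in brillouin d, ∑ b, (∑ j, c j * siteFourierMode b (g j) k) ^ 2 = (2 * π) ^ d * ∑ j, c j ^ 2 := by
  classical
  rw [integral_brillouin_sum_sq_sum_mul_siteFourierMode]
  congr 1
  refine Finset.sum_congr rfl fun j _ => ?_
  rw [Finset.sum_eq_single j]
  · simp [sq]
  · intro j' _ hj'
    have h : g j ≠ g j' := fun h => hj' (hg h).symm
    simp [h]
  · simp


/-! ### The Fourier weight of the Green function -/

/-- The Fourier weight `w(k) = (2 (2π)^d ε(k))⁻¹` is measurable. [folklore] -/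
@[fun_prop]
theorem measurable_greenFourierWeight : Measurable (greenFourierWeight d) := by
  unfold greenFourierWeight
  exact ((continuous_const.mul (continuous_dispersion d)).measurable).inv

/-- The Fourier weight is integrable on the Brillouin zone for `d ≥ 3` (tree
`integrable_indicator_inv_dispersion`). [folklore] -/
theorem integrable_greenFourierWeight (hd : 3 ≤ d) :
    Integrable (greenFourierWeight d) ((volume : Measure (Fin d → ℝ)).restrict (brillouin d)) := by
  have h1 : IntegrableOn (fun p : Fin d → ℝ => 1 / dispersion p) (brillouin d) volume :=
    (integrable_indicator_iff (measurableSet_brillouin d)).1 (integrable_indicator_inv_dispersion d hd)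
  have h2 := h1.const_mul (2 * (2 * π) ^ d)⁻¹
  refine h2.congr (ae_of_all _ fun k => ?_)
  simp only [greenFourierWeight, one_div, mul_inv]

/-- `w · f` is integrable on the Brillouin zone for every bounded measurable `f` (`d ≥ 3`).
[folklore] -/
theorem integrable_greenFourierWeight_mul_of_bound (hd : 3 ≤ d) {f : (Fin d → ℝ) → ℝ}
    (hf : Measurable f) {C : ℝ} (hC : ∀ k, |f k| ≤ C) :
    Integrable (fun k => greenFourierWeight d k * f k) ((volume : Measure (Fin d → ℝ)).restrict (brillouin d)) := by
  refine (integrable_greenFourierWeight hd).mul_bdd (c := C) hf.aestronglyMeasurable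
    (ae_of_all _ fun k => ?_)
  rw [Real.norm_eq_abs]
  exact hC k

/-- **Fourier representation of the Green function**: `G(z)/2 = ∫_{[-π,π]^d} w(k) cos (k·z) dk`
(`G = latticeGreen`; an identity of Bochner integrals, cf. `half_latticeGreen_sub_eq_integral`).
[folklore] -/
theorem half_latticeGreen_eq_integral_cos (z : Literature.Probability.LatticeModels.Site d) :
    latticeGreen z / 2 = ∫ k in brillouin d, greenFourierWeight d k * Real.cos (∑ i, k i * (z i : ℝ)) := by
  simp_rw [greenFourierWeight_mul_cos]
  rw [integral_const_mul, latticeGreen_eq]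
  have hπ : (2 * π) ^ d ≠ 0 := by positivity
  field_simp

/-- The Fourier symbol of a second difference: `2 cos (k·z) - cos (k·(z + e_m)) - cos (k·(z - e_m))
= 2 (1 - cos k_m) cos (k·z)`. [folklore] -/
theorem two_mul_cos_sub_cos_add_single_sub_cos_sub_single (k : Fin d → ℝ)
    (z : Literature.Probability.LatticeModels.Site d) (m : Fin d) :
    2 * Real.cos (∑ i, k i * (z i : ℝ)) -
          Real.cos (∑ i, k i * ((z + Pi.single m 1 : Literature.Probability.LatticeModels.Site d) i : ℝ)) -
        Real.cos (∑ i, k i * ((z - Pi.single m 1 : Literature.Probability.LatticeModels.Site d) i : ℝ)) =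
      2 * (1 - Real.cos (k m)) * Real.cos (∑ i, k i * (z i : ℝ)) := by
  rw [sum_mul_intCast_add_single, sum_mul_intCast_sub_single, Real.cos_add, Real.cos_sub]
  ring

/-- **Fourier representation of the transverse second difference of the Green function**:
`(2G(z) - G(z + e_m) - G(z - e_m))/2 = ∫ w(k) · 2(1 - cos k_m) · cos (k·z) dk` (`d ≥ 3`).
[folklore] -/
theorem secondDiff_latticeGreen_eq_integral (hd : 3 ≤ d) (z : Literature.Probability.LatticeModels.Site d)
    (m : Fin d) :
    (2 * latticeGreen z - latticeGreen (z + Pi.single m 1) - latticeGreen (z - Pi.single m 1)) / 2 =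
      ∫ k in brillouin d, greenFourierWeight d k * (2 * (1 - Real.cos (k m))) *
        Real.cos (∑ i, k i * (z i : ℝ)) := by
  have hint : ∀ u : Literature.Probability.LatticeModels.Site d,
      Integrable (fun k => greenFourierWeight d k * Real.cos (∑ i, k i * (u i : ℝ)))
        ((volume : Measure (Fin d → ℝ)).restrict (brillouin d)) := fun u =>
    integrable_greenFourierWeight_mul_of_bound hd (by fun_prop) (C := 1) fun k => Real.abs_cos_le_one _
  have h1 := half_latticeGreen_eq_integral_cos z
  have h2 := half_latticeGreen_eq_integral_cos (z + Pi.single m 1)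
  have h3 := half_latticeGreen_eq_integral_cos (z - Pi.single m 1)
  have hsplit : (2 * latticeGreen z - latticeGreen (z + Pi.single m 1) - latticeGreen (z - Pi.single m 1)) / 2 =
      2 * (latticeGreen z / 2) - latticeGreen (z + Pi.single m 1) / 2 - latticeGreen (z - Pi.single m 1) / 2 := by
    ring
  have key : (∫ k in brillouin d, greenFourierWeight d k * (2 * (1 - Real.cos (k m))) *
        Real.cos (∑ i, k i * (z i : ℝ))) =
      ∫ k in brillouin d, (2 * (greenFourierWeight d k * Real.cos (∑ i, k i * (z i : ℝ))) -
          greenFourierWeight d k *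
            Real.cos (∑ i, k i * ((z + Pi.single m 1 : Literature.Probability.LatticeModels.Site d) i : ℝ))) -
        greenFourierWeight d k *
          Real.cos (∑ i, k i * ((z - Pi.single m 1 : Literature.Probability.LatticeModels.Site d) i : ℝ)) := by
    refine integral_congr_ae (ae_of_all _ fun k => ?_)
    simp only
    rw [mul_assoc, ← two_mul_cos_sub_cos_add_single_sub_cos_sub_single k z m]
    ring
  rw [hsplit, h1, h2, h3, key, integral_sub, integral_sub, integral_const_mul]
  all_goals first
    | exact ((hint z).const_mul 2).sub (hint _)
    | exact (hint z).const_mul 2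
    | exact hint _

/-! ### The kernel between parallel plaquettes -/

/-- **Parallel plaquettes, position space**: for `p = (x; i<j)`, `q = (y; i<j)`, `z = x - y`,
`K(p, q) = (2G(z) - G(z+eⱼ) - G(z-eⱼ))/2 + (2G(z) - G(z+eᵢ) - G(z-eᵢ))/2` with `G = latticeGreen`
(the transverse second differences; of the sixteen pairs of boundary edges only the eight
same-direction pairs contribute). The same computation is recorded route-side as
`Summit.QuantumFields.YangMills.Cruxes.SourcedPressureIncrement.Birth.curvatureTwoPoint_parallel_eq`.
[folklore] -/
theorem curvatureTwoPoint_plane_eq (x y : Literature.Probability.LatticeModels.Site d)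
    (P : {p : Fin d × Fin d // p.1 < p.2}) :
    curvatureTwoPoint ((x, P) : ZdPlaquette d) (y, P) =
      (2 * latticeGreen (x - y) - latticeGreen (x - y + Pi.single P.1.2 1) -
            latticeGreen (x - y - Pi.single P.1.2 1)) / 2 +
        (2 * latticeGreen (x - y) - latticeGreen (x - y + Pi.single P.1.1 1) -
            latticeGreen (x - y - Pi.single P.1.1 1)) / 2 := by
  obtain ⟨⟨i, j⟩, hij⟩ := P
  have hne : i ≠ j := ne_of_lt hij
  have hne' : j ≠ i := fun h => hne h.symm
  simp only [curvatureTwoPoint, Fin.sum_univ_four, plaquetteBoundary, plaquetteBoundarySign, edgeGreen_apply,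
    Matrix.cons_val_zero, Matrix.cons_val_one, Matrix.cons_val, if_true, hne, hne', if_false]
  have e1 : x - (y + Pi.single j 1) = x - y - Pi.single j 1 := by abel
  have e2 : x + Pi.single j 1 - y = x - y + Pi.single j 1 := by abel
  have e3 : x + Pi.single j 1 - (y + Pi.single j 1) = x - y := by abel
  have e4 : x + Pi.single i 1 - (y + Pi.single i 1) = x - y := by abel
  have e5 : x + Pi.single i 1 - y = x - y + Pi.single i 1 := by abel
  have e6 : x - (y + Pi.single i 1) = x - y - Pi.single i 1 := by abel
  simp only [e1, e2, e3, e4, e5, e6]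
  ring

/-- **Parallel plaquettes, momentum space**: `K((x;i<j), (y;i<j)) =
∫_{[-π,π]^d} w(k) · 2((1 - cos kᵢ) + (1 - cos kⱼ)) · cos (k·(x - y)) dk`, i.e.
`(2π)^{-d} ∫ m(k) cos (k·(x-y)) dk` with the multiplier
`m(k) = ((1 - cos kᵢ) + (1 - cos kⱼ))/ε(k) ∈ [0, 1]` (`d ≥ 3`). [folklore] -/
theorem curvatureTwoPoint_plane_eq_integral (hd : 3 ≤ d) (x y : Literature.Probability.LatticeModels.Site d)
    (P : {p : Fin d × Fin d // p.1 < p.2}) :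
    curvatureTwoPoint ((x, P) : ZdPlaquette d) (y, P) =
      ∫ k in brillouin d, greenFourierWeight d k *
          (2 * ((1 - Real.cos (k P.1.1)) + (1 - Real.cos (k P.1.2)))) *
        Real.cos (∑ i, k i * ((x - y) i : ℝ)) := by
  have hint : ∀ m : Fin d, Integrable (fun k => greenFourierWeight d k * (2 * (1 - Real.cos (k m))) *
      Real.cos (∑ i, k i * ((x - y) i : ℝ))) ((volume : Measure (Fin d → ℝ)).restrict (brillouin d)) := by
    intro m
    have h := integrable_greenFourierWeight_mul_of_bound hd (C := 4)
      (f := fun k => (2 * (1 - Real.cos (k m))) * Real.cos (∑ i, k i * ((x - y) i : ℝ))) (by fun_prop)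
      (fun k => by
        rw [abs_mul]
        have h1 : |2 * (1 - Real.cos (k m))| ≤ 4 := by
          rw [abs_le]
          constructor <;> nlinarith [Real.cos_le_one (k m), Real.neg_one_le_cos (k m)]
        have h2 : |Real.cos (∑ i, k i * ((x - y) i : ℝ))| ≤ 1 := Real.abs_cos_le_one _
        nlinarith [abs_nonneg (2 * (1 - Real.cos (k m))), abs_nonneg (Real.cos (∑ i, k i * ((x - y) i : ℝ)))])
    refine h.congr (ae_of_all _ fun k => ?_)
    simp only
    ring
  rw [curvatureTwoPoint_plane_eq, secondDiff_latticeGreen_eq_integral hd, secondDiff_latticeGreen_eq_integral hd,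
    ← integral_add (hint _) (hint _)]
  refine integral_congr_ae (ae_of_all _ fun k => ?_)
  simp only
  ring


/-! ### The quadratic form in momentum space -/

/-- Bounds on the one-plane multiplier: `0 ≤ w(k) · 2((1 - cos kᵢ) + (1 - cos kⱼ)) ≤ (2π)^{-d}`
for `i ≠ j`, because `(1 - cos kᵢ) + (1 - cos kⱼ) ≤ ε(k) = ∑_l (1 - cos k_l)`. [folklore] -/
theorem greenFourierWeight_mul_plane_multiplier_le {i j : Fin d} (hij : i ≠ j) (k : Fin d → ℝ) :
    greenFourierWeight d k * (2 * ((1 - Real.cos (k i)) + (1 - Real.cos (k j)))) ≤ ((2 * π) ^ d)⁻¹ := by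
  have hπ : (0 : ℝ) < (2 * π) ^ d := by positivity
  by_cases hε : dispersion k = 0
  · simp only [greenFourierWeight, hε, mul_zero, inv_zero, zero_mul]
    positivity
  have hεpos : 0 < dispersion k := lt_of_le_of_ne (dispersion_nonneg k) (Ne.symm hε)
  have hS : (1 - Real.cos (k i)) + (1 - Real.cos (k j)) ≤ dispersion k := by
    unfold dispersion
    rw [show (1 - Real.cos (k i)) + (1 - Real.cos (k j)) = ∑ l ∈ ({i, j} : Finset (Fin d)), (1 - Real.cos (k l)) from
      (Finset.sum_pair (f := fun l => 1 - Real.cos (k l)) hij).symm]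
    exact Finset.sum_le_sum_of_subset_of_nonneg (Finset.subset_univ _)
      (fun l _ _ => sub_nonneg.mpr (Real.cos_le_one (k l)))
  rw [greenFourierWeight]
  rw [show (2 * (2 * π) ^ d * dispersion k)⁻¹ * (2 * ((1 - Real.cos (k i)) + (1 - Real.cos (k j)))) =
      ((2 * π) ^ d)⁻¹ * (((1 - Real.cos (k i)) + (1 - Real.cos (k j))) / dispersion k) by
    field_simp]
  calc ((2 * π) ^ d)⁻¹ * (((1 - Real.cos (k i)) + (1 - Real.cos (k j))) / dispersion k)
      ≤ ((2 * π) ^ d)⁻¹ * 1 := by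
        gcongr
        exact (div_le_one hεpos).mpr hS
    _ = ((2 * π) ^ d)⁻¹ := mul_one _

/-- `0 ≤ w(k) · 2((1 - cos kᵢ) + (1 - cos kⱼ))`. [folklore] -/
theorem greenFourierWeight_mul_plane_multiplier_nonneg (i j : Fin d) (k : Fin d → ℝ) :
    0 ≤ greenFourierWeight d k * (2 * ((1 - Real.cos (k i)) + (1 - Real.cos (k j)))) := by
  have h1 := Real.cos_le_one (k i)
  have h2 := Real.cos_le_one (k j)
  have := greenFourierWeight_nonneg (d := d) k
  positivity

/-- **The one-plane quadratic form in momentum space**: for every finite family `g` of sites and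
coefficients `c`,
`∑ⱼⱼ' cⱼ cⱼ' K((gⱼ;P),(gⱼ';P)) = ∫_{[-π,π]^d} w(k) · 2((1 - cos kᵢ) + (1 - cos kⱼ)) · ∑_b (∑ⱼ cⱼ φ_b(gⱼ,k))² dk`
(`d ≥ 3`). [folklore] -/
theorem sum_sum_mul_mul_curvatureTwoPoint_plane_eq_integral (hd : 3 ≤ d)
    (P : {p : Fin d × Fin d // p.1 < p.2}) {J : Type*} [Fintype J]
    (g : J → Literature.Probability.LatticeModels.Site d) (c : J → ℝ) :
    ∑ j, ∑ j', c j * c j' * curvatureTwoPoint ((g j, P) : ZdPlaquette d) (g j', P) =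
      ∫ k in brillouin d, greenFourierWeight d k *
          (2 * ((1 - Real.cos (k P.1.1)) + (1 - Real.cos (k P.1.2)))) *
        ∑ b, (∑ j, c j * siteFourierMode b (g j) k) ^ 2 := by
  have hI : ∀ j j', Integrable (fun k : Fin d → ℝ => c j * c j' * (greenFourierWeight d k *
      (2 * ((1 - Real.cos (k P.1.1)) + (1 - Real.cos (k P.1.2)))) *
        Real.cos (∑ i, k i * ((g j - g j') i : ℝ)))) ((volume : Measure (Fin d → ℝ)).restrict (brillouin d)) := by
    intro j j'
    refine Integrable.const_mul ?_ _
    have h := integrable_greenFourierWeight_mul_of_bound hd (C := 8)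
      (f := fun k => (2 * ((1 - Real.cos (k P.1.1)) + (1 - Real.cos (k P.1.2)))) *
        Real.cos (∑ i, k i * ((g j - g j') i : ℝ))) (by fun_prop)
      (fun k => by
        rw [abs_mul]
        have h1 : |2 * ((1 - Real.cos (k P.1.1)) + (1 - Real.cos (k P.1.2)))| ≤ 8 := by
          rw [abs_le]
          constructor <;> nlinarith [Real.cos_le_one (k P.1.1), Real.neg_one_le_cos (k P.1.1),
            Real.cos_le_one (k P.1.2), Real.neg_one_le_cos (k P.1.2)]
        have h2 : |Real.cos (∑ i, k i * ((g j - g j') i : ℝ))| ≤ 1 := Real.abs_cos_le_one _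
        nlinarith [abs_nonneg (2 * ((1 - Real.cos (k P.1.1)) + (1 - Real.cos (k P.1.2)))),
          abs_nonneg (Real.cos (∑ i, k i * ((g j - g j') i : ℝ)))])
    refine h.congr (ae_of_all _ fun k => ?_)
    simp only
    ring
  symm
  calc (∫ k in brillouin d, greenFourierWeight d k *
          (2 * ((1 - Real.cos (k P.1.1)) + (1 - Real.cos (k P.1.2)))) *
        ∑ b, (∑ j, c j * siteFourierMode b (g j) k) ^ 2)
      = ∫ k in brillouin d, ∑ j, ∑ j', c j * c j' * (greenFourierWeight d k *
          (2 * ((1 - Real.cos (k P.1.1)) + (1 - Real.cos (k P.1.2)))) *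
            Real.cos (∑ i, k i * ((g j - g j') i : ℝ))) := by
        refine integral_congr_ae (ae_of_all _ fun k => ?_)
        simp only
        rw [sum_sq_sum_mul_siteFourierMode, Finset.mul_sum]
        refine Finset.sum_congr rfl fun j _ => ?_
        rw [Finset.mul_sum]
        exact Finset.sum_congr rfl fun j' _ => by ring
    _ = ∑ j, ∑ j', ∫ k in brillouin d, c j * c j' * (greenFourierWeight d k *
          (2 * ((1 - Real.cos (k P.1.1)) + (1 - Real.cos (k P.1.2)))) *
            Real.cos (∑ i, k i * ((g j - g j') i : ℝ))) := by
        rw [integral_finsetSum _ fun j _ => integrable_finsetSum _ fun j' _ => hI j j']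
        exact Finset.sum_congr rfl fun j _ => integral_finsetSum _ fun j' _ => hI j j'
    _ = ∑ j, ∑ j', c j * c j' * curvatureTwoPoint ((g j, P) : ZdPlaquette d) (g j', P) := by
        refine Finset.sum_congr rfl fun j _ => Finset.sum_congr rfl fun j' _ => ?_
        rw [integral_const_mul, curvatureTwoPoint_plane_eq_integral hd]

/-- **The one-plane quadratic form is nonnegative** (positive semidefiniteness along families of
parallel plaquettes; the general statement is `isPosSemidefKernel_curvatureCovKernel`). [folklore] -/
theorem sum_sum_mul_mul_curvatureTwoPoint_plane_nonneg (hd : 3 ≤ d)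
    (P : {p : Fin d × Fin d // p.1 < p.2}) {J : Type*} [Fintype J]
    (g : J → Literature.Probability.LatticeModels.Site d) (c : J → ℝ) :
    0 ≤ ∑ j, ∑ j', c j * c j' * curvatureTwoPoint ((g j, P) : ZdPlaquette d) (g j', P) := by
  rw [sum_sum_mul_mul_curvatureTwoPoint_plane_eq_integral hd]
  refine integral_nonneg_of_ae (ae_of_all _ fun k => ?_)
  exact mul_nonneg (greenFourierWeight_mul_plane_multiplier_nonneg _ _ k)
    (Finset.sum_nonneg fun b _ => sq_nonneg _)

end Summit.QuantumFields.YangMills.Theorems.CurvatureKernel
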